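import Literature.NumberTheory.GaloisRepresentations.TeichmullerLiftLocalShape
import HarnessLib

/-!
# Twisting a monomial representation by a character of its diagonal subgroup:
# `Ind χ ↦ Ind (χ ξ)` in matrix form (Allen 2014, Lemma 87, "Serre's trick")

Theorems only (no definition of a notion, no named fact; D-0026), written by the seat of the
named fact `Literature.NumberTheory.Automorphic.Allen2014_modularity_nearlyOrdinaryDihedral_Q`
(P. B. Allen, Compositio Math. 150 (2014) = arXiv:1301.1113), continuing
`TeichmullerLiftMonomial` / `TeichmullerLiftLocalShape` with the group-theoretic core of the
step of Lemma 87 (OrdinaryLift) known as Serre's trick, arXiv:1301.1113 p. 70: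

> "If there is some choice of complex conjugation at which `ρ̄` is trivial, we use a trick of
> Serre. […] there is a character `ξ : G_L → ℚ̄ˣ` of order either two or four, such that `ξ`
> [is] nontrivial at each `{σ₁, …, σ_k}` and trivial at each `{σ'₁, …, σ'_k}` as well as at
> every place above `2`. […] We set `ρ₁ = Ind_{G_L}^{G_F} χ ξ`.  Since `ξ` has order two or
> four, it is trivial mod `2`, and `ρ₁` is a lift of `ρ̄`.  By choice of `ξ`, the lift `ρ₁` is
> totally odd.  Also, because `ξ` is trivial at any place above `2` we have
> `ρ₁|_{G_v} ≅ (χ'_v 0 ; 0 χ_v)`."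

In the tree's matrix language the induced representation `Ind_{G_L}^{G_F} χ` is a MONOMIAL
homomorphism `ρ₀ : G → GL₂(R)` with respect to a subgroup `Hm ≤ G` of index two (`ρ₀(h)`
diagonal for `h ∈ Hm`, antidiagonal otherwise) and `Ind (χ ξ)` is its TWIST by a function
`ξ : G → R` multiplicative on `Hm` (a character of `Hm = G_L`, extended anyhow):
`ρ(h) = diag(ξ(h), ξ(c₀⁻¹ h c₀)) ρ₀(h)` for `h ∈ Hm` and
`ρ(g) = diag(ξ(g c₀), ξ(c₀⁻¹ g)) ρ₀(g)` for `g ∉ Hm`, `c₀ ∉ Hm` a fixed coset representative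
(`exists_monoidHom_twist_of_monomial`: this IS a homomorphism — the cocycle identity of the
induced representation, checked case by case).  The three sentences quoted are then:

* "trivial mod `2` ⟹ a lift of `ρ̄`": `integralReduction_eq_of_twist` (over `ℤ̄_p`: if
  `ξ ≡ 1 (mod 𝔪)` on `Hm`, the twist has the same reduction), with
  `twist_entry_eq_zero_or_pow_eq_one` (entries `0` or roots of unity again);
* "totally odd": `det_twist_of_mem` (`det ρ(h) = ξ(h) ξ(c₀⁻¹ h c₀) det ρ₀(h)` for `h ∈ Hm`)
  and `det_twist_of_not_mem` (`det ρ(g) = ξ(g c₀) ξ(c₀⁻¹ g) det ρ₀(g)` for `g ∉ Hm`; at an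
  involution `g ∉ Hm` the factor is `ξ(g c₀ c₀⁻¹ g) = ξ(1) = 1`, `det_twist_eq_of_not_mem_of_mul_self`);
* "trivial at any place above `2` ⟹ `ρ₁|_{G_v} ≅ χ'_v ⊕ χ_v`": `twist_comp_eq_of_forall_eq_one`
  — on a subgroup `f : H' → G` where `ξ` is trivial (on `f(H') ∩ Hm` and its `c₀`-conjugate,
  with `c₀ ∈ f(H')` in the non-split case) the twist AGREES with `ρ₀`, so the local shape
  `exists_conjGL_diagonal_comp_of_monomial` of `ρ₀` is that of the twist.

The number-theoretic input of Serre's trick — the existence of `ξ` with prescribed local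
behaviour ([Artin–Tate, Ch. X, Thm. 5], Grunwald–Wang) — is not touched here.

## References

* P. B. Allen, Compositio Math. 150 (2014) 1235–1346, Lemma 87 (= arXiv:1301.1113, §5.1.1,
  p. 70). [Allen2014]
* J.-P. Serre, *Modular forms of weight one and Galois representations*, in: Algebraic Number
  Fields (Durham 1975), Academic Press (1977), §8 (the trick). [Serre1977WeightOne]
-/

noncomputable section

open scoped MatrixGroups
open Matrix IsLocalRing

namespace Literature.NumberTheory.GaloisRepresentations

/-! ### The twist of a monomial representation (any commutative ring) -/

section Twist

variable {G : Type*} [Group G] {R : Type*} [CommRing R]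

/-- Index-two bookkeeping: if the product of any two elements outside `Hm` lies in `Hm` and
`c₀ ∉ Hm`, then `c₀⁻¹ ∉ Hm`, `c₀ c₀ ∈ Hm`, `Hm` is stable under conjugation by `c₀`, and
`g c₀, c₀⁻¹ g ∈ Hm` for `g ∉ Hm`. [folklore] -/
theorem indexTwo_mem_lemmas (Hm : Subgroup G) (c₀ : G) (hc₀ : c₀ ∉ Hm)
    (h2 : ∀ g g', g ∉ Hm → g' ∉ Hm → g * g' ∈ Hm) :
    c₀⁻¹ ∉ Hm ∧ c₀ * c₀ ∈ Hm ∧ (∀ h ∈ Hm, c₀⁻¹ * h * c₀ ∈ Hm) ∧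
      (∀ g ∉ Hm, g * c₀ ∈ Hm) ∧ (∀ g ∉ Hm, c₀⁻¹ * g ∈ Hm) ∧
      (∀ h ∈ Hm, ∀ g ∉ Hm, h * g ∉ Hm) ∧ (∀ g ∉ Hm, ∀ h ∈ Hm, g * h ∉ Hm) := by
  have hc₀' : c₀⁻¹ ∉ Hm := fun h => hc₀ (by simpa using Hm.inv_mem h)
  refine ⟨hc₀', h2 _ _ hc₀ hc₀, fun h hh => ?_, fun g hg => h2 _ _ hg hc₀,
    fun g hg => h2 _ _ hc₀' hg, fun h hh g hg hmem => ?_, fun g hg h hh hmem => ?_⟩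
  · have h1 : c₀⁻¹ * h ∉ Hm := fun h' => hc₀' (by simpa using Hm.mul_mem h' (Hm.inv_mem hh))
    exact h2 _ _ h1 hc₀
  · exact hg (by simpa using Hm.mul_mem (Hm.inv_mem hh) hmem)
  · exact hg (by simpa using Hm.mul_mem hmem (Hm.inv_mem hh))

/-- **The twist `Ind χ ↦ Ind (χ ξ)` of a monomial representation is a homomorphism** (Allen
2014, Lemma 87: "We set `ρ₁ = Ind_{G_L}^{G_F} χ ξ`").  Let `ρ₀ : G → GL₂(R)` be monomial with
respect to the subgroup `Hm` of index two (`ρ₀(h)` diagonal for `h ∈ Hm`, antidiagonal for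
`g ∉ Hm`; `c₀ ∉ Hm`), and let `ξ : G → R` be multiplicative on `Hm` with unit values there.
Then there is a homomorphism `ρ : G → GL₂(R)` with `ρ(h) = diag(ξ(h), ξ(c₀⁻¹ h c₀)) ρ₀(h)` for
`h ∈ Hm` and `ρ(g) = diag(ξ(g c₀), ξ(c₀⁻¹ g)) ρ₀(g)` for `g ∉ Hm` — the induced representation
of the twisted character, in the same monomial frame.
[cite: Allen2014, Lemma 87 (arXiv:1301.1113, §5.1.1, p. 70)] -/
theorem exists_monoidHom_twist_of_monomial (ρ₀ : G →* GL (Fin 2) R) (Hm : Subgroup G) (c₀ : G)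
    (hc₀ : c₀ ∉ Hm) (h2 : ∀ g g', g ∉ Hm → g' ∉ Hm → g * g' ∈ Hm)
    (hdg : ∀ h ∈ Hm, (ρ₀ h).val 0 1 = 0 ∧ (ρ₀ h).val 1 0 = 0)
    (had : ∀ g ∉ Hm, (ρ₀ g).val 0 0 = 0 ∧ (ρ₀ g).val 1 1 = 0)
    (ξ : G → R) (hξ : ∀ x ∈ Hm, ∀ y ∈ Hm, ξ (x * y) = ξ x * ξ y)
    (hξu : ∀ x ∈ Hm, IsUnit (ξ x)) :
    ∃ ρ : G →* GL (Fin 2) R,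
      (∀ h ∈ Hm, (ρ h).val = Matrix.diagonal ![ξ h, ξ (c₀⁻¹ * h * c₀)] * (ρ₀ h).val) ∧
      (∀ g ∉ Hm, (ρ g).val = Matrix.diagonal ![ξ (g * c₀), ξ (c₀⁻¹ * g)] * (ρ₀ g).val) := by
  classical
  obtain ⟨hc₀', hcc, hconj, hgc, hcg, hmul_not, hnot_mul⟩ := indexTwo_mem_lemmas Hm c₀ hc₀ h2
  have hξ1 : ξ 1 = 1 := by
    have h : ξ 1 * ξ 1 = ξ 1 * 1 := by rw [mul_one, ← hξ 1 Hm.one_mem 1 Hm.one_mem, one_mul]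
    exact (hξu 1 Hm.one_mem).mul_left_cancel h
  -- the diagonal factors
  set a : G → R := fun g => if g ∈ Hm then ξ g else ξ (g * c₀) with ha
  set b : G → R := fun g => if g ∈ Hm then ξ (c₀⁻¹ * g * c₀) else ξ (c₀⁻¹ * g) with hb
  -- `ρ₀ g` moves a diagonal matrix past itself, swapping its entries iff `g ∉ Hm`
  have hcomm : ∀ g (x y : R), (ρ₀ g).val * Matrix.diagonal ![x, y] =
      (if g ∈ Hm then Matrix.diagonal ![x, y] else Matrix.diagonal ![y, x]) * (ρ₀ g).val := by
    intro g x y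
    split_ifs with hg
    · obtain ⟨h01, h10⟩ := hdg g hg
      ext i j
      fin_cases i <;> fin_cases j <;> simp [Matrix.mul_diagonal, Matrix.diagonal_mul, h01, h10, mul_comm]
    · obtain ⟨h00, h11⟩ := had g hg
      ext i j
      fin_cases i <;> fin_cases j <;> simp [Matrix.mul_diagonal, Matrix.diagonal_mul, h00, h11, mul_comm]
  -- the cocycle identity of the induced representation, case by case
  have hkey : ∀ g g', a (g * g') = a g * (if g ∈ Hm then a g' else b g') ∧
      b (g * g') = b g * (if g ∈ Hm then b g' else a g') := by
    intro g g'
    by_cases hg : g ∈ Hm <;> by_cases hg' : g' ∈ Hm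
    · have hgg' : g * g' ∈ Hm := Hm.mul_mem hg hg'
      simp only [ha, hb, if_pos hg, if_pos hg', if_pos hgg']
      refine ⟨hξ _ hg _ hg', ?_⟩
      rw [show c₀⁻¹ * (g * g') * c₀ = (c₀⁻¹ * g * c₀) * (c₀⁻¹ * g' * c₀) by group]
      exact hξ _ (hconj g hg) _ (hconj g' hg')
    · have hgg' : g * g' ∉ Hm := hmul_not g hg g' hg'
      simp only [ha, hb, if_pos hg, if_neg hg', if_neg hgg']
      refine ⟨?_, ?_⟩
      · rw [show g * g' * c₀ = g * (g' * c₀) by group]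
        exact hξ _ hg _ (hgc g' hg')
      · rw [show c₀⁻¹ * (g * g') = (c₀⁻¹ * g * c₀) * (c₀⁻¹ * g') by group]
        exact hξ _ (hconj g hg) _ (hcg g' hg')
    · have hgg' : g * g' ∉ Hm := hnot_mul g hg g' hg'
      simp only [ha, hb, if_neg hg, if_pos hg', if_neg hgg']
      refine ⟨?_, ?_⟩
      · rw [show g * g' * c₀ = (g * c₀) * (c₀⁻¹ * g' * c₀) by group]
        exact hξ _ (hgc g hg) _ (hconj g' hg')
      · rw [show c₀⁻¹ * (g * g') = (c₀⁻¹ * g) * g' by group]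
        exact hξ _ (hcg g hg) _ hg'
    · have hgg' : g * g' ∈ Hm := h2 g g' hg hg'
      simp only [ha, hb, if_neg hg, if_neg hg', if_pos hgg']
      refine ⟨?_, ?_⟩
      · rw [show g * g' = (g * c₀) * (c₀⁻¹ * g') by group]
        exact hξ _ (hgc g hg) _ (hcg g' hg')
      · rw [show c₀⁻¹ * (g * g') * c₀ = (c₀⁻¹ * g) * (g' * c₀) by group]
        exact hξ _ (hcg g hg) _ (hgc g' hg')
  -- the twisted matrices and their multiplicativity
  set M : G → Matrix (Fin 2) (Fin 2) R := fun g => Matrix.diagonal ![a g, b g] * (ρ₀ g).val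
    with hM
  have hMmul : ∀ g g', M (g * g') = M g * M g' := by
    intro g g'
    obtain ⟨ka, kb⟩ := hkey g g'
    have hD : Matrix.diagonal ![a (g * g'), b (g * g')] =
        Matrix.diagonal ![a g, b g] *
          (if g ∈ Hm then Matrix.diagonal ![a g', b g'] else Matrix.diagonal ![b g', a g']) := by
      split_ifs at ka kb ⊢ with hg
      · rw [Matrix.diagonal_mul_diagonal, ka, kb]
        ext i j
        fin_cases i <;> fin_cases j <;> simp [Matrix.diagonal_apply_eq, Matrix.diagonal_apply_ne]
      · rw [Matrix.diagonal_mul_diagonal, ka, kb]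
        ext i j
        fin_cases i <;> fin_cases j <;> simp [Matrix.diagonal_apply_eq, Matrix.diagonal_apply_ne]
    simp only [hM]
    rw [hD, map_mul, Units.val_mul, Matrix.mul_assoc (Matrix.diagonal ![a g, b g]) (ρ₀ g).val,
      ← Matrix.mul_assoc (ρ₀ g).val, hcomm g (a g') (b g')]
    split_ifs <;> simp only [Matrix.mul_assoc]
  have hM1 : M 1 = 1 := by
    have ha1 : a 1 = 1 := by simp only [ha, if_pos Hm.one_mem, hξ1]
    have hb1 : b 1 = 1 := by
      simp only [hb, if_pos Hm.one_mem, mul_one, inv_mul_cancel, hξ1]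
    simp only [hM]
    rw [ha1, hb1, map_one, Units.val_one, Matrix.mul_one]
    ext i j
    fin_cases i <;> fin_cases j <;> simp [Matrix.diagonal_apply_eq, Matrix.diagonal_apply_ne]
  let U : G → GL (Fin 2) R := fun g =>
    ⟨M g, M g⁻¹, by rw [← hMmul, mul_inv_cancel, hM1], by rw [← hMmul, inv_mul_cancel, hM1]⟩
  let ρ : G →* GL (Fin 2) R := MonoidHom.mk' U fun g g' => Units.ext (hMmul g g')
  refine ⟨ρ, fun h hh => ?_, fun g hg => ?_⟩
  · change M h = _
    simp only [hM, ha, hb, if_pos hh]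
  · change M g = _
    simp only [hM, ha, hb, if_neg hg]

variable {ρ ρ₀ : G →* GL (Fin 2) R} {Hm : Subgroup G} {c₀ : G} {ξ : G → R}

/-- Entries of the twist on `Hm`: the rows of `ρ₀(h)` scaled by `ξ(h)`, `ξ(c₀⁻¹ h c₀)`. [folklore] -/
theorem twist_apply_of_mem
    (hρ : ∀ h ∈ Hm, (ρ h).val = Matrix.diagonal ![ξ h, ξ (c₀⁻¹ * h * c₀)] * (ρ₀ h).val)
    {h : G} (hh : h ∈ Hm) (j : Fin 2) :
    (ρ h).val 0 j = ξ h * (ρ₀ h).val 0 j ∧ (ρ h).val 1 j = ξ (c₀⁻¹ * h * c₀) * (ρ₀ h).val 1 j := by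
  rw [hρ h hh, Matrix.diagonal_mul, Matrix.diagonal_mul]
  exact ⟨by simp, by simp⟩

/-- Entries of the twist off `Hm`: the rows of `ρ₀(g)` scaled by `ξ(g c₀)`, `ξ(c₀⁻¹ g)`. [folklore] -/
theorem twist_apply_of_not_mem
    (hρ' : ∀ g ∉ Hm, (ρ g).val = Matrix.diagonal ![ξ (g * c₀), ξ (c₀⁻¹ * g)] * (ρ₀ g).val)
    {g : G} (hg : g ∉ Hm) (j : Fin 2) :
    (ρ g).val 0 j = ξ (g * c₀) * (ρ₀ g).val 0 j ∧ (ρ g).val 1 j = ξ (c₀⁻¹ * g) * (ρ₀ g).val 1 j := by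
  rw [hρ' g hg, Matrix.diagonal_mul, Matrix.diagonal_mul]
  exact ⟨by simp, by simp⟩

/-- **"By choice of `ξ`, the lift `ρ₁` is totally odd"**, the determinant on `Hm`:
`det ρ(h) = ξ(h) ξ(c₀⁻¹ h c₀) det ρ₀(h)` for `h ∈ Hm`.
[cite: Allen2014, Lemma 87 (arXiv:1301.1113, §5.1.1, p. 70)] -/
theorem det_twist_of_mem
    (hρ : ∀ h ∈ Hm, (ρ h).val = Matrix.diagonal ![ξ h, ξ (c₀⁻¹ * h * c₀)] * (ρ₀ h).val)
    {h : G} (hh : h ∈ Hm) :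
    ((ρ h).val).det = ξ h * ξ (c₀⁻¹ * h * c₀) * ((ρ₀ h).val).det := by
  rw [hρ h hh, Matrix.det_mul, Matrix.det_diagonal, Fin.prod_univ_two]
  simp

/-- The determinant of the twist off `Hm`: `det ρ(g) = ξ(g c₀) ξ(c₀⁻¹ g) det ρ₀(g)`. [folklore] -/
theorem det_twist_of_not_mem
    (hρ' : ∀ g ∉ Hm, (ρ g).val = Matrix.diagonal ![ξ (g * c₀), ξ (c₀⁻¹ * g)] * (ρ₀ g).val)
    {g : G} (hg : g ∉ Hm) :
    ((ρ g).val).det = ξ (g * c₀) * ξ (c₀⁻¹ * g) * ((ρ₀ g).val).det := by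
  rw [hρ' g hg, Matrix.det_mul, Matrix.det_diagonal, Fin.prod_univ_two]
  simp

/-- **At an involution outside `Hm` the twist does not change the determinant** (so complex
conjugations `c ∉ G_L` stay odd): if `g ∉ Hm` and `g g = 1` then `det ρ(g) = det ρ₀(g)`, the
factor being `ξ(g c₀) ξ(c₀⁻¹ g) = ξ(g c₀ c₀⁻¹ g) = ξ(1) = 1`. [folklore] -/
theorem det_twist_eq_of_not_mem_of_mul_self (hc₀ : c₀ ∉ Hm)
    (h2 : ∀ g g', g ∉ Hm → g' ∉ Hm → g * g' ∈ Hm)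
    (hξ : ∀ x ∈ Hm, ∀ y ∈ Hm, ξ (x * y) = ξ x * ξ y) (hξu : ∀ x ∈ Hm, IsUnit (ξ x))
    (hρ' : ∀ g ∉ Hm, (ρ g).val = Matrix.diagonal ![ξ (g * c₀), ξ (c₀⁻¹ * g)] * (ρ₀ g).val)
    {g : G} (hg : g ∉ Hm) (hgg : g * g = 1) :
    ((ρ g).val).det = ((ρ₀ g).val).det := by
  obtain ⟨-, -, -, hgc, hcg, -, -⟩ := indexTwo_mem_lemmas Hm c₀ hc₀ h2
  have hξ1 : ξ 1 = 1 := by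
    have h : ξ 1 * ξ 1 = ξ 1 * 1 := by rw [mul_one, ← hξ 1 Hm.one_mem 1 Hm.one_mem, one_mul]
    exact (hξu 1 Hm.one_mem).mul_left_cancel h
  rw [det_twist_of_not_mem hρ' hg, ← hξ _ (hgc g hg) _ (hcg g hg),
    show g * c₀ * (c₀⁻¹ * g) = g * g by group, hgg, hξ1, one_mul]

/-- **"Because `ξ` is trivial at any place above `2` we have `ρ₁|_{G_v} ≅ (χ'_v 0 ; 0 χ_v)`"**:
on a subgroup `f : H' → G` such that `ξ = 1` on `f(H') ∩ Hm` and on `c₀⁻¹ f(H') c₀ ∩ Hm`, and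
such that either `f(H') ⊆ Hm` (the place splits in `L`) or `c₀ ∈ f(H')` (it does not, and the
coset representative is taken in the decomposition group), the twist agrees with `ρ₀`:
`ρ ∘ f = ρ₀ ∘ f`.  Hence every statement about `ρ₀ ∘ f` — in particular the diagonal form of
`exists_conjGL_diagonal_comp_of_monomial` — holds for `ρ ∘ f`.
[cite: Allen2014, Lemma 87 (arXiv:1301.1113, §5.1.1, p. 70)] -/
theorem twist_comp_eq_of_forall_eq_one {H' : Type*} [Group H'] (f : H' →* G) (hc₀ : c₀ ∉ Hm)
    (h2 : ∀ g g', g ∉ Hm → g' ∉ Hm → g * g' ∈ Hm)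
    (hρ : ∀ h ∈ Hm, (ρ h).val = Matrix.diagonal ![ξ h, ξ (c₀⁻¹ * h * c₀)] * (ρ₀ h).val)
    (hρ' : ∀ g ∉ Hm, (ρ g).val = Matrix.diagonal ![ξ (g * c₀), ξ (c₀⁻¹ * g)] * (ρ₀ g).val)
    (hξf : ∀ k, f k ∈ Hm → ξ (f k) = 1) (hξf' : ∀ k, c₀⁻¹ * f k * c₀ ∈ Hm → ξ (c₀⁻¹ * f k * c₀) = 1)
    (hsplit : (∀ k, f k ∈ Hm) ∨ ∃ k₀, f k₀ = c₀) :
    ρ.comp f = ρ₀.comp f := by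
  obtain ⟨-, -, hconj, hgc, hcg, -, -⟩ := indexTwo_mem_lemmas Hm c₀ hc₀ h2
  have hone : Matrix.diagonal ![(1 : R), 1] = 1 := by
    ext i j
    fin_cases i <;> fin_cases j <;> simp [Matrix.diagonal_apply_eq, Matrix.diagonal_apply_ne]
  refine MonoidHom.ext fun k => Units.ext ?_
  rw [MonoidHom.comp_apply, MonoidHom.comp_apply]
  by_cases hk : f k ∈ Hm
  · rw [hρ _ hk, hξf k hk, hξf' k (hconj _ hk), hone, Matrix.one_mul]
  · rcases hsplit with hall | ⟨k₀, hk₀⟩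
    · exact absurd (hall k) hk
    · rw [hρ' _ hk]
      have e1 : ξ (f k * c₀) = 1 := by
        rw [← hk₀, ← map_mul]
        exact hξf _ (by rw [map_mul, hk₀]; exact hgc _ hk)
      have e2 : ξ (c₀⁻¹ * f k) = 1 := by
        rw [← hk₀, ← map_inv, ← map_mul]
        exact hξf _ (by rw [map_mul, map_inv, hk₀]; exact hcg _ hk)
      rw [e1, e2, hone, Matrix.one_mul]

end Twist

/-! ### The twist over `ℤ̄_p`: same reduction, root-of-unity entries -/

section Padic

variable {p : ℕ} [Fact p.Prime] {G : Type*} [Group G]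
variable {ρ ρ₀ : G →* GL (Fin 2) (padicAlgClIntegers p)} {Hm : Subgroup G} {c₀ : G}
  {ξ : G → padicAlgClIntegers p}

/-- **"Since `ξ` has order two or four, it is trivial mod `2`, and `ρ₁` is a lift of `ρ̄`"**:
if `ξ ≡ 1 (mod 𝔪)` on `Hm` then the twist of `ρ₀ : G → GL₂(ℤ̄_p)` has the same reduction as
`ρ₀`. [cite: Allen2014, Lemma 87 (arXiv:1301.1113, §5.1.1, p. 70)] -/
theorem integralReduction_eq_of_twist (hc₀ : c₀ ∉ Hm)
    (h2 : ∀ g g', g ∉ Hm → g' ∉ Hm → g * g' ∈ Hm)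
    (hρ : ∀ h ∈ Hm, (ρ h).val = Matrix.diagonal ![ξ h, ξ (c₀⁻¹ * h * c₀)] * (ρ₀ h).val)
    (hρ' : ∀ g ∉ Hm, (ρ g).val = Matrix.diagonal ![ξ (g * c₀), ξ (c₀⁻¹ * g)] * (ρ₀ g).val)
    (hξres : ∀ x ∈ Hm, residue (padicAlgClIntegers p) (ξ x) = 1) :
    integralReduction (RingHom.id _) ρ = integralReduction (RingHom.id _) ρ₀ := by
  obtain ⟨-, -, hconj, hgc, hcg, -, -⟩ := indexTwo_mem_lemmas Hm c₀ hc₀ h2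
  refine MonoidHom.ext fun g => Units.ext (Matrix.ext fun i j => ?_)
  rw [integralReduction_apply_coe, integralReduction_apply_coe, RingHom.id_apply, RingHom.id_apply]
  by_cases hg : g ∈ Hm
  · obtain ⟨h0, h1⟩ := twist_apply_of_mem hρ hg j
    fin_cases i
    · simp [h0, hξres _ hg]
    · simp [h1, hξres _ (hconj _ hg)]
  · obtain ⟨h0, h1⟩ := twist_apply_of_not_mem hρ' hg j
    fin_cases i
    · simp [h0, hξres _ (hgc _ hg)]
    · simp [h1, hξres _ (hcg _ hg)]

/-- The entries of the twist are again `0` or roots of unity: if the entries of `ρ₀` are `0` or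
`n`-th roots of unity and `ξ(x)^m = 1` on `Hm`, the entries of the twist are `0` or
`(n m)`-th roots of unity. [folklore] -/
theorem twist_entry_eq_zero_or_pow_eq_one {n m : ℕ} (hc₀ : c₀ ∉ Hm)
    (h2 : ∀ g g', g ∉ Hm → g' ∉ Hm → g * g' ∈ Hm)
    (hρ : ∀ h ∈ Hm, (ρ h).val = Matrix.diagonal ![ξ h, ξ (c₀⁻¹ * h * c₀)] * (ρ₀ h).val)
    (hρ' : ∀ g ∉ Hm, (ρ g).val = Matrix.diagonal ![ξ (g * c₀), ξ (c₀⁻¹ * g)] * (ρ₀ g).val)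
    (hroots : ∀ g i j, (ρ₀ g).val i j = 0 ∨ ((ρ₀ g).val i j : PadicAlgCl p) ^ n = 1)
    (hξm : ∀ x ∈ Hm, (ξ x : PadicAlgCl p) ^ m = 1) (g : G) (i j : Fin 2) :
    (ρ g).val i j = 0 ∨ ((ρ g).val i j : PadicAlgCl p) ^ (n * m) = 1 := by
  obtain ⟨-, -, hconj, hgc, hcg, -, -⟩ := indexTwo_mem_lemmas Hm c₀ hc₀ h2
  -- each entry is `ξ(x) · (ρ₀ g) i j` for some `x ∈ Hm`
  have key : ∀ (x : G), x ∈ Hm → ∀ (e : padicAlgClIntegers p),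
      (e = 0 ∨ (e : PadicAlgCl p) ^ n = 1) →
      ξ x * e = 0 ∨ ((ξ x * e : padicAlgClIntegers p) : PadicAlgCl p) ^ (n * m) = 1 := by
    intro x hx e he
    rcases he with he | he
    · left
      rw [he, mul_zero]
    · right
      rw [MulMemClass.coe_mul, mul_pow, mul_comm n m, pow_mul, hξm x hx, one_pow, one_mul, pow_mul',
        he, one_pow]
  have hi : i = 0 ∨ i = 1 := by fin_cases i <;> simp
  by_cases hg : g ∈ Hm
  · obtain ⟨h0, h1⟩ := twist_apply_of_mem hρ hg j
    rcases hi with rfl | rfl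
    · rw [h0]
      exact key g hg _ (hroots g 0 j)
    · rw [h1]
      exact key _ (hconj g hg) _ (hroots g 1 j)
  · obtain ⟨h0, h1⟩ := twist_apply_of_not_mem hρ' hg j
    rcases hi with rfl | rfl
    · rw [h0]
      exact key _ (hgc g hg) _ (hroots g 0 j)
    · rw [h1]
      exact key _ (hcg g hg) _ (hroots g 1 j)

/-- The kernel of the twist contains the elements of `ker ρ₀ ∩ Hm` at which `ξ` and
`ξ(c₀⁻¹ · c₀)` are trivial (used to see that the twist of an Artin representation by a
locally constant `ξ` is again continuous). [folklore] -/
theorem twist_eq_one_of_mem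
    (hρ : ∀ h ∈ Hm, (ρ h).val = Matrix.diagonal ![ξ h, ξ (c₀⁻¹ * h * c₀)] * (ρ₀ h).val)
    {h : G} (hh : h ∈ Hm) (h0 : ρ₀ h = 1) (h1 : ξ h = 1) (h2 : ξ (c₀⁻¹ * h * c₀) = 1) :
    ρ h = 1 := by
  refine Units.ext ?_
  rw [hρ h hh, h0, h1, h2, Units.val_one, Matrix.mul_one]
  ext i j
  fin_cases i <;> fin_cases j <;> simp [Matrix.diagonal_apply_eq, Matrix.diagonal_apply_ne]

end Padic

end Literature.NumberTheory.GaloisRepresentations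

end
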